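import Summits.AtomisticToContinuum.FouriersLaw.Theorems.IncoherentChannel.Negative.GibbsStein
import Summits.AtomisticToContinuum.FouriersLaw.Theorems.PhononMeanFreePathHarmonicCoherentPersistenceDampedFlow

/-!
# IncoherentChannel, line `two-horizons-forecast-loss`: the Gibbs kinetic moment along the free harmonic flow is `C¹`

Support for crux `PhononMeanFreePath.IncoherentChannel` (item stmt-AtomisticToContinuum-11811),
lead c6, stub W-E `harmonic_freeFlow_sqMomentum_hasDerivAt`.

For the pinned HARMONIC chain `P = pinnedChain ω₂ 0 0 γ` (`ω₂, γ > 0`), its deterministic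
(zero-noise) damped flow `Φ_t z = P.chainFlow n z 0 t` and the Gibbs measure `μ_T` (`T > 0`), the
kinetic moment `S(t) = ∫ ((Φ_t z)_{p_i})² dμ_T(z)` is continuous on `ℝ` and, for `t > 0`,
differentiable with `S'(t) = ∫ 2 (Φ_t z)_{p_i} (Y(Φ_t z))_{p_i} dμ_T(z)` (`Y = P.drift n` the
Langevin drift): dominated continuity / differentiation under the Gibbs integral
(`MeasureTheory.continuous_of_dominated`, `hasDerivAt_integral_of_dominated_loc_of_deriv_le`).
The pointwise ODE `d/dt (Φ_t z)_{p_i} = (Y(Φ_t z))_{p_i}` is the tree's `hasDerivAt_flat_freeFlow`;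
the `t`-UNIFORM majorant `K · H(z)` comes from the energy decay `H(Φ_t z) ≤ H(z)` of the free flow
(`pinnedChain_hamiltonian_freeFlow_le`), coercivity `‖x‖² ≤ c H(x)` (`norm_sq_le_mul_hamiltonian`),
the linear bound `|Y(x)_{p_i}| ≤ D‖x‖` (the harmonic drift is a linear map of a finite-dimensional
space) and Gibbs-integrability of `H` (`H ≤ 2T e^{H/(2T)}`).
-/

noncomputable section

namespace Summit.AtomisticToContinuum.FouriersLaw.Theorems.PhononMeanFreePath

open MeasureTheory Set Filter Topology
open scoped NNReal
open Literature.MathematicalPhysics.KineticTheory.HeatConduction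
open Summit.AtomisticToContinuum.FouriersLaw.Theorems.IncoherentChannel.Negative.HarmonicFlow
open Summit.AtomisticToContinuum.FouriersLaw.Theorems.IncoherentChannel.Negative.KernelMoments
open Summit.AtomisticToContinuum.FouriersLaw.Theorems.HarmonicCoherentPersistence

namespace HarmonicKineticMoment

section Helpers

variable {ω₂ γ : ℝ} (hω : 0 < ω₂) (hγ : 0 < γ) (n : ℕ)

/-- The harmonic Langevin drift `Y` (linear force, linear friction) is a continuous linear map of
phase space. [folklore] -/
theorem harmonic_drift_exists_clm :
    ∃ L : PhaseSpace n →L[ℝ] PhaseSpace n, ∀ x, (pinnedChain ω₂ 0 0 γ).drift n x = L x :=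
  ⟨LinearMap.toContinuousLinearMap
      { toFun := (pinnedChain ω₂ 0 0 γ).drift n
        map_add' := harmonic_drift_add n
        map_smul' := harmonic_drift_smul n },
    fun _ => rfl⟩

/-- A linear bound on the momentum components of the harmonic drift: `|Y(x)_{p_i}| ≤ D ‖x‖`.
[folklore] -/
theorem harmonic_drift_snd_abs_le :
    ∃ D : ℝ, 0 ≤ D ∧ ∀ (x : PhaseSpace n) (i : Fin n),
      |((pinnedChain ω₂ 0 0 γ).drift n x).2 i| ≤ D * ‖x‖ := by
  obtain ⟨L, hL⟩ := harmonic_drift_exists_clm (ω₂ := ω₂) (γ := γ) n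
  refine ⟨‖L‖, norm_nonneg _, fun x i => ?_⟩
  rw [hL]
  exact (OscillatorChain.abs_snd_apply_le_norm (L x) i).trans (L.le_opNorm x)

include hω hγ in
/-- **`d/dt (Φ_t z)_{p_i} = (Y(Φ_t z))_{p_i}`** for `t > 0` along the free harmonic flow
(the `p_i`-row of `ẇ = A w`, `Y(x)♭ = A x♭`). [folklore] -/
theorem hasDerivAt_harmonic_freeFlow_snd (z : PhaseSpace n) (i : Fin n) {t : ℝ} (ht : 0 < t) :
    HasDerivAt (fun s => ((pinnedChain ω₂ 0 0 γ).chainFlow n z 0 s).2 i)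
      (((pinnedChain ω₂ 0 0 γ).drift n ((pinnedChain ω₂ 0 0 γ).chainFlow n z 0 t)).2 i) t := by
  have h := hasDerivAt_flat_freeFlow hω hγ n z (Sum.inr i) ht
  rw [← flat_harmonic_drift ω₂ γ n] at h
  simpa only [flat_inr] using h

include hω hγ in
/-- Product rule: `d/dt (Φ_t z)_{p_i}² = 2 (Φ_t z)_{p_i} (Y(Φ_t z))_{p_i}` for `t > 0`. [folklore] -/
theorem hasDerivAt_harmonic_freeFlow_snd_sq (z : PhaseSpace n) (i : Fin n) {t : ℝ} (ht : 0 < t) :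
    HasDerivAt (fun s => (((pinnedChain ω₂ 0 0 γ).chainFlow n z 0 s).2 i) ^ 2)
      (2 * ((pinnedChain ω₂ 0 0 γ).chainFlow n z 0 t).2 i *
        ((pinnedChain ω₂ 0 0 γ).drift n ((pinnedChain ω₂ 0 0 γ).chainFlow n z 0 t)).2 i) t := by
  have h := hasDerivAt_harmonic_freeFlow_snd hω hγ n z i ht
  refine ((h.mul h).congr_of_eventuallyEq (Eventually.of_forall fun s => pow_two _)).congr_deriv ?_
  ring

include hω hγ in
/-- **`t`-uniform energy domination**: `(Φ_t z)_{p_i}² ≤ 2 max(ω₂⁻¹, 1) · H(z)` for every `t`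
(coercivity at `Φ_t z` and `H(Φ_t z) ≤ H(z)`). [folklore] -/
theorem harmonic_freeFlow_snd_sq_le (z : PhaseSpace n) (i : Fin n) (t : ℝ) :
    (((pinnedChain ω₂ 0 0 γ).chainFlow n z 0 t).2 i) ^ 2 ≤
      2 * max ω₂⁻¹ 1 * (pinnedChain ω₂ 0 0 γ).hamiltonian n z := by
  have h1 := OscillatorChain.abs_snd_apply_le_norm ((pinnedChain ω₂ 0 0 γ).chainFlow n z 0 t) i
  have h2 := norm_sq_le_mul_hamiltonian hω le_rfl le_rfl γ ((pinnedChain ω₂ 0 0 γ).chainFlow n z 0 t)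
  have h3 := pinnedChain_hamiltonian_freeFlow_le hω le_rfl le_rfl hγ.le n z t
  have h4 : (((pinnedChain ω₂ 0 0 γ).chainFlow n z 0 t).2 i) ^ 2 ≤
      ‖(pinnedChain ω₂ 0 0 γ).chainFlow n z 0 t‖ ^ 2 := by
    rw [← sq_abs]
    exact pow_le_pow_left₀ (abs_nonneg _) h1 2
  have hc : (0 : ℝ) ≤ 2 * max ω₂⁻¹ 1 := by positivity
  exact h4.trans (h2.trans (mul_le_mul_of_nonneg_left h3 hc))

include hω in
/-- **The Hamiltonian is Gibbs-integrable** (`H ≤ 2T e^{H/(2T)}` and `e^{H/(2T)} ∈ L¹(μ_T)`).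
[folklore] -/
theorem integrable_hamiltonian_gibbsMeasure {T : ℝ} (hT : 0 < T) :
    Integrable ((pinnedChain ω₂ 0 0 γ).hamiltonian n) ((pinnedChain ω₂ 0 0 γ).gibbsMeasure n T) := by
  have hHc : Continuous ((pinnedChain ω₂ 0 0 γ).hamiltonian n) :=
    (pinnedChain_contDiff_hamiltonian ω₂ 0 0 γ n (n := 0)).continuous
  have hT2 : 0 < 2 * T := by positivity
  have hϑ : 1 / (2 * T) < 1 / T := one_div_lt_one_div_of_lt hT (by linarith)
  have hE := (pinnedChain_integrable_exp_mul_hamiltonian_gibbsMeasure hω le_rfl le_rfl γ n hT hϑ).const_mul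
    (2 * T)
  refine hE.mono' hHc.aestronglyMeasurable (Eventually.of_forall fun x => ?_)
  have hH0 := pinnedChain_hamiltonian_nonneg hω.le le_rfl le_rfl γ n x
  rw [Real.norm_eq_abs, abs_of_nonneg hH0]
  have h1 := Real.add_one_le_exp (1 / (2 * T) * (pinnedChain ω₂ 0 0 γ).hamiltonian n x)
  calc (pinnedChain ω₂ 0 0 γ).hamiltonian n x
      = 2 * T * (1 / (2 * T) * (pinnedChain ω₂ 0 0 γ).hamiltonian n x) := by field_simp
    _ ≤ 2 * T * Real.exp (1 / (2 * T) * (pinnedChain ω₂ 0 0 γ).hamiltonian n x) :=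
        mul_le_mul_of_nonneg_left (by linarith) hT2.le

end Helpers

end HarmonicKineticMoment

open HarmonicKineticMoment

/-- **W-E (dominated continuity / differentiation of the Gibbs kinetic moment along the free
harmonic flow).** For the harmonic chain `P = pinnedChain ω₂ 0 0 γ` (`ω₂, γ > 0`), `T > 0` and a
site `i`, `S(t) = ∫ ((Φ_t z)_{p_i})² dμ_T(z)` is continuous on `ℝ` and, for `t > 0`, has derivative
`∫ 2 (Φ_t z)_{p_i} (Y(Φ_t z))_{p_i} dμ_T(z)`: differentiation under the Gibbs integral with the
`t`-uniform integrable majorant `K · H(z)`. [folklore] -/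
theorem harmonic_freeFlow_sqMomentum_hasDerivAt : ∀ ω₂ γ : ℝ, 0 < ω₂ → 0 < γ → ∀ T : ℝ, 0 < T → ∀ (n : ℕ) (i : Fin n), Continuous (fun s : ℝ => ∫ z, (((pinnedChain ω₂ 0 0 γ).chainFlow n z 0 s).2 i) ^ 2 ∂((pinnedChain ω₂ 0 0 γ).gibbsMeasure n T)) ∧ ∀ t : ℝ, 0 < t → HasDerivAt (fun s : ℝ => ∫ z, (((pinnedChain ω₂ 0 0 γ).chainFlow n z 0 s).2 i) ^ 2 ∂((pinnedChain ω₂ 0 0 γ).gibbsMeasure n T)) (∫ z, 2 * ((pinnedChain ω₂ 0 0 γ).chainFlow n z 0 t).2 i * ((pinnedChain ω₂ 0 0 γ).drift n ((pinnedChain ω₂ 0 0 γ).chainFlow n z 0 t)).2 i ∂((pinnedChain ω₂ 0 0 γ).gibbsMeasure n T)) t := by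
  intro ω₂ γ hω hγ T hT n i
  obtain ⟨D, hD0, hD⟩ := harmonic_drift_snd_abs_le (ω₂ := ω₂) (γ := γ) n
  set c : ℝ := 2 * max ω₂⁻¹ 1 with hc
  have hc0 : 0 ≤ c := by positivity
  -- continuity of the flow in `z` and in `t`, of the drift
  have hΦz : ∀ s : ℝ, Continuous fun z : PhaseSpace n => (pinnedChain ω₂ 0 0 γ).chainFlow n z 0 s :=
    fun s => pinnedChain_continuous_chainFlow_left hω le_rfl le_rfl hγ.le n (η := 0) continuous_zero s
  have hΦt : ∀ z : PhaseSpace n, Continuous fun s : ℝ => (pinnedChain ω₂ 0 0 γ).chainFlow n z 0 s :=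
    fun z => pinnedChain_continuous_chainFlow hω le_rfl le_rfl hγ.le n z (η := 0) continuous_zero
  have hYc : Continuous ((pinnedChain ω₂ 0 0 γ).drift n) :=
    (pinnedChain_contDiff_drift ω₂ 0 0 γ n (n := 0)).continuous
  have hai : ∀ s : ℝ, Continuous fun z : PhaseSpace n => ((pinnedChain ω₂ 0 0 γ).chainFlow n z 0 s).2 i :=
    fun s => (continuous_apply i).comp (hΦz s).snd
  have hbi : ∀ s : ℝ, Continuous fun z : PhaseSpace n =>
      ((pinnedChain ω₂ 0 0 γ).drift n ((pinnedChain ω₂ 0 0 γ).chainFlow n z 0 s)).2 i :=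
    fun s => (continuous_apply i).comp (hYc.comp (hΦz s)).snd
  -- the integrable majorant `H`
  have hHi := integrable_hamiltonian_gibbsMeasure (γ := γ) hω n hT
  -- pointwise `t`-uniform bounds
  have hb1 : ∀ (s : ℝ) (z : PhaseSpace n), ‖(((pinnedChain ω₂ 0 0 γ).chainFlow n z 0 s).2 i) ^ 2‖ ≤
      c * (pinnedChain ω₂ 0 0 γ).hamiltonian n z := fun s z => by
    rw [Real.norm_eq_abs, abs_of_nonneg (sq_nonneg _)]
    exact harmonic_freeFlow_snd_sq_le hω hγ n z i s
  have hb2 : ∀ (s : ℝ) (z : PhaseSpace n), ‖2 * ((pinnedChain ω₂ 0 0 γ).chainFlow n z 0 s).2 i *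
      ((pinnedChain ω₂ 0 0 γ).drift n ((pinnedChain ω₂ 0 0 γ).chainFlow n z 0 s)).2 i‖ ≤
      2 * D * c * (pinnedChain ω₂ 0 0 γ).hamiltonian n z := fun s z => by
    set x := (pinnedChain ω₂ 0 0 γ).chainFlow n z 0 s with hx
    have h1 := OscillatorChain.abs_snd_apply_le_norm x i
    have h2 := hD x i
    have h3 : ‖x‖ ^ 2 ≤ c * (pinnedChain ω₂ 0 0 γ).hamiltonian n z :=
      (norm_sq_le_mul_hamiltonian hω le_rfl le_rfl γ x).trans
        (mul_le_mul_of_nonneg_left (pinnedChain_hamiltonian_freeFlow_le hω le_rfl le_rfl hγ.le n z s) hc0)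
    rw [Real.norm_eq_abs, abs_mul, abs_mul, abs_two]
    calc 2 * |x.2 i| * |((pinnedChain ω₂ 0 0 γ).drift n x).2 i| ≤ 2 * ‖x‖ * (D * ‖x‖) := by gcongr
      _ = 2 * D * ‖x‖ ^ 2 := by ring
      _ ≤ 2 * D * (c * (pinnedChain ω₂ 0 0 γ).hamiltonian n z) :=
          mul_le_mul_of_nonneg_left h3 (by positivity)
      _ = 2 * D * c * (pinnedChain ω₂ 0 0 γ).hamiltonian n z := by ring
  -- measurability in `z`
  have hFm : ∀ s : ℝ, AEStronglyMeasurable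
      (fun z : PhaseSpace n => (((pinnedChain ω₂ 0 0 γ).chainFlow n z 0 s).2 i) ^ 2)
      ((pinnedChain ω₂ 0 0 γ).gibbsMeasure n T) := fun s => ((hai s).pow 2).aestronglyMeasurable
  have hF'm : ∀ s : ℝ, AEStronglyMeasurable
      (fun z : PhaseSpace n => 2 * ((pinnedChain ω₂ 0 0 γ).chainFlow n z 0 s).2 i *
        ((pinnedChain ω₂ 0 0 γ).drift n ((pinnedChain ω₂ 0 0 γ).chainFlow n z 0 s)).2 i)
      ((pinnedChain ω₂ 0 0 γ).gibbsMeasure n T) :=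
    fun s => ((continuous_const.mul (hai s)).mul (hbi s)).aestronglyMeasurable
  refine ⟨?_, fun t ht => ?_⟩
  · exact continuous_of_dominated hFm (fun s => Eventually.of_forall fun z => hb1 s z) (hHi.const_mul c)
      (Eventually.of_forall fun z => ((continuous_apply i).comp (hΦt z).snd).pow 2)
  · have key := hasDerivAt_integral_of_dominated_loc_of_deriv_le
      (μ := (pinnedChain ω₂ 0 0 γ).gibbsMeasure n T)
      (F := fun (s : ℝ) (z : PhaseSpace n) => (((pinnedChain ω₂ 0 0 γ).chainFlow n z 0 s).2 i) ^ 2)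
      (F' := fun (s : ℝ) (z : PhaseSpace n) => 2 * ((pinnedChain ω₂ 0 0 γ).chainFlow n z 0 s).2 i *
        ((pinnedChain ω₂ 0 0 γ).drift n ((pinnedChain ω₂ 0 0 γ).chainFlow n z 0 s)).2 i)
      (bound := fun z => 2 * D * c * (pinnedChain ω₂ 0 0 γ).hamiltonian n z)
      (Ioi_mem_nhds ht) (Eventually.of_forall hFm)
      ((hHi.const_mul c).mono' (hFm t) (Eventually.of_forall fun z => hb1 t z)) (hF'm t)
      (Eventually.of_forall fun z s _ => hb2 s z) (hHi.const_mul _)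
      (Eventually.of_forall fun z s hs => hasDerivAt_harmonic_freeFlow_snd_sq hω hγ n z i hs)
    exact key.2

end Summit.AtomisticToContinuum.FouriersLaw.Theorems.PhononMeanFreePath

end
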